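import Literature.AlgebraicGeometry.HodgeTheory.RibetTypeOfCorePowersHodgeClasses
import Literature.AlgebraicGeometry.Motives.HodgeThetaSubalgebraUnitarySevenThirteenCore
import HarnessLib

/-!
# Hodge classes on all powers of abelian TWENTYFOLDS of Ribet type `(7, 13)` are generated by divisor classes
# (Ribet 1983 Thm. 3 at `(7, 13)` — UNCONDITIONAL, classification-free)

Family `hodge`, layer `Literature/AlgebraicGeometry/HodgeTheory`. Research context: cell `pub-hodge-ring2` (HONEST
FRAMING: research route conditional on HC_CM; not a corollary; Q11.4-sentence-2 already refuted in dim ≥ 3),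
Literature lane gen 83, programme R65. UNCONDITIONAL for the class of abelian varieties it names; theorems only, no
definition, no named fact (D-0026), no `sorry`. The CELL of the generic assembly `RibetTypeOfCorePowersHodgeClasses` at
the core `UnitarySeven.eq_top_seven_thirteen` / `eq_top_thirteen_seven`.

## References
* [Ribet1983] K. A. Ribet, Amer. J. Math. 105 (1983), Thm. 0, Thm. 3.
* [Gordon1997] B. B. Gordon, *A survey of the Hodge conjecture for abelian varieties*, Thm. 6.3 (3) and Corollary.
* [Deligne2000] P. Deligne, *The Hodge conjecture* (Clay, 2000), §1.
-/

noncomputable section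

open CategoryTheory Module

namespace Literature.AlgebraicGeometry.HodgeTheory

open Literature.AlgebraicGeometry.Motives
open Literature.AlgebraicGeometry.Motives.HodgeStructure

section Cells

/-- **Ribet 1983 Thm. 3 at `(7, 13)` — UNCONDITIONAL: `B•(A^{N+1}) = D•(A^{N+1}) ⊗ ℂ`** for a complex abelian
TWENTYFOLD `A` with `φ ≫ φ = -d` (`d > 0`), `finrank_ℚ End⁰(A) = 2` and a multiplicity equal to `7`.
[cite: Ribet1983, Thm. 0 and Thm. 3] [cite: Gordon1997, Thm. 6.3 (3) and Corollary] -/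
theorem AbelianVariety.isDivisorGenerated_powSucc_of_twentyfold_sevenThirteen (A : AbelianVariety ℂ) (φ : A ⟶ A)
    {d : ℕ} (hd : 0 < d) (hφ : φ ≫ φ = -(d • 𝟙 A)) (hE2 : Module.finrank ℚ A.endAlgebra = 2) (hdim : A.dim = 20)
    (h7 : eigenMultiplicity A φ (Complex.I * (Real.sqrt d : ℂ)) = 7 ∨
      eigenMultiplicity A φ (-(Complex.I * (Real.sqrt d : ℂ))) = 7) (N : ℕ) :
    IsDivisorGenerated (A.powSucc N) := by
  have hsum := eigenMultiplicity_add_eigenMultiplicity_neg_eq_dim A φ hd hφ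
  rw [hdim] at hsum
  refine AbelianVariety.isDivisorGenerated_powSucc_of_ribetType_ofCore A φ hd hφ hE2 (by omega) (by omega) ?_ N
  intro W' _ _ _ 𝔊 ι P' Q' s hbr hirr hι hιι hP' hQ' hfinP' hfinQ' hadd hsymm hPQ hdefP hdefQ hadj
  rcases h7 with h | h
  · exact UnitarySeven.eq_top_seven_thirteen hbr hirr hι hιι hP' hQ' (by rw [hfinP', h]) (by rw [hfinQ']; omega)
      hadd hsymm hPQ hdefP hdefQ hadj
  · exact UnitarySeven.eq_top_thirteen_seven hbr hirr hι hιι hP' hQ' (by rw [hfinP']; omega) (by rw [hfinQ', h])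
      hadd hsymm hPQ hdefP hdefQ hadj

/-- **The Hodge conjecture for all powers of an abelian twentyfold of unitary type `(7, 13)` — UNCONDITIONAL.**
[cite: Ribet1983, Thm. 3] [cite: Deligne2000, §1] -/
theorem hodgeConjectureFor_powSucc_of_twentyfold_sevenThirteen (A : AbelianVariety ℂ) (φ : A ⟶ A)
    {d : ℕ} (hd : 0 < d) (hφ : φ ≫ φ = -(d • 𝟙 A)) (hE2 : Module.finrank ℚ A.endAlgebra = 2) (hdim : A.dim = 20)
    (h7 : eigenMultiplicity A φ (Complex.I * (Real.sqrt d : ℂ)) = 7 ∨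
      eigenMultiplicity A φ (-(Complex.I * (Real.sqrt d : ℂ))) = 7) (N : ℕ) :
    HodgeConjectureFor (A.powSucc N).dim (A.powSucc N).X :=
  hodgeConjectureFor_of_isDivisorGenerated _
    (AbelianVariety.isDivisorGenerated_powSucc_of_twentyfold_sevenThirteen A φ hd hφ hE2 hdim h7 N)

end Cells

end Literature.AlgebraicGeometry.HodgeTheory

end
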